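import Literature.Computability.MetaComplexity.EFModMulUOne
import HarnessLib

/-!
# The shift law of uniform modular multiplication: one more multiplier bit is one more stage

Layer E/5 (uniform variant). `ModMulU.ShiftMul.isBlock_lines`: for two available certified
multipliers `V = w ⊗ b` and `V' = w ⊗ b'` with the same multiplicand and modulus, where the
multiplier of `V` has `k ≥ 1` leading zero bits (the zero gate), that of `V'` has `k - 1`, and
the remaining bits are the same variables shifted by one stage (`b'_{L-1-t} = b_{L-2-t}`), the
partial products align: `P_t(V') ≡ P_{t+1}(V)` for `k - 1 ≤ t ≤ L - 1`; in particular
`P_{L-1}(V') ≡ P_L(V)`. With `b = c >> (L - s)` and `b' = c >> (L - s - 1)` this is the step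
`w ⊗ (c >> (L-s-1)) = 2 (w ⊗ (c >> (L-s))) + c_{L-1-s} w` of the commutativity and
associativity inductions, up to the last stage of `V'`.

The proof: both multipliers start with zero partial products through their zero phases
(`ModMulU.Zero`), then stage `t` of `V'` and stage `t + 1` of `V` are congruent
(`ModAddU.PairData.leibLines` for the doubling and the accumulation, the Leibniz rule of the
mask gates).

## Sources

* S. A. Cook, R. A. Reckhow, *The relative efficiency of propositional proof systems*,
  J. Symbolic Logic 44 (1979), §2.
-/

namespace Literature.Computability.MetaComplexity

open _root_.Computability Complexity Complexity.PropForm Netlist Cluster FregeSystem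

namespace ModMulU

namespace ShiftMul

variable (L : ℕ) (K : PropForm ℕ) (V V' : View) (k : ℕ)

/-- The false masks of the zero phase of `V` (stages `t < k`). [folklore] -/
def maskF (V : View) (k : ℕ) : List (PropForm ℕ) :=
  ((List.range k).map fun t => (List.range L).map fun i => ctx K (neg (var (V.msk L t i)))).flatten

/-- The stage `t = k - 1 + j` of the aligned phase: `n`-reflexivity is global; the doubling,
the masks, the accumulation. [folklore] -/
def stage (t : ℕ) : List (PropForm ℕ) :=
  (⟨V'.Dv L t, V.Dv L (t + 1), L⟩ : ModAddU.PairData).leibLines K ++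
    ((List.range L).map (fun i => ctx K (eqv (V'.msk L t i) (V.msk L (t + 1) i))) ++
      (⟨V'.Av L t, V.Av L (t + 1), L⟩ : ModAddU.PairData).leibLines K)

/-- The aligned phase up to `j` stages after the base `t = k - 1`. [folklore] -/
def alUpTo : ℕ → List (PropForm ℕ)
  | 0 => (List.range L).map fun i => ctx K (eqv (V'.P L (k - 1) i) (V.P L k i))
  | j + 1 => alUpTo j ++ stage L K V V' (k - 1 + j)

/-- **The lines of the shift law.** [folklore] -/
def lines (z : ℕ) : List (PropForm ℕ) :=
  [ctx K (neg (var z))] ++ (maskF L K V k ++ (Zero.upTo V L K k ++ (maskF L K V' (k - 1) ++ (Zero.upTo V' L K (k - 1) ++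
    (Adder.reflLines K ((List.range L).map V.n ++ (List.range L).map V.a ++ (List.range L).map (fun t => V.b (L - 1 - t))) ++
      alUpTo L K V V' k (L - k))))))

variable {L K V V' k} {G : FregeSystem} {Γ : Set (PropForm ℕ)}

/-- Membership in the false masks. [folklore] -/
theorem mem_maskF {V : View} {k t i : ℕ} (ht : t < k) (hi : i < L) : ctx K (neg (var (V.msk L t i))) ∈ maskF L K V k :=
  List.mem_flatten.2 ⟨_, List.mem_map.2 ⟨t, List.mem_range.2 ht, rfl⟩, List.mem_map.2 ⟨i, List.mem_range.2 hi, rfl⟩⟩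

/-- **The false masks of a zero phase form a block.** [cite: CookReckhow1979, §2] -/
theorem isBlock_maskF (hGL : ∀ r ∈ Logic.rules, r ∈ G.rules) {V : View} (hV : V.Avail L K Γ) {k z : ℕ} (hk : k ≤ L)
    (hVb : ∀ t < k, V.b (L - 1 - t) = z) (hz : ctx K (neg (var z)) ∈ Γ) : G.IsBlock Γ (maskF L K V k) := by
  refine Scaffold.isBlock_of_forall fun θ hθ => ?_
  obtain ⟨l, hl, hθ⟩ := List.mem_flatten.1 hθ
  obtain ⟨t, ht, rfl⟩ := List.mem_map.1 hl
  rw [List.mem_range] at ht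
  obtain ⟨i, hi, rfl⟩ := List.mem_map.1 hθ
  rw [List.mem_range] at hi
  exact Or.inr (Logic.infer hGL 16 (by decide) (FregeSystem.sub [K, var (V.msk L t i), var (V.b (L - 1 - t)), var (V.a i)]) rfl
    (FregeSystem.prems_cons (hV.hmk t (by omega) i hi) (FregeSystem.prems_cons (by rw [hVb t ht]; exact hz) FregeSystem.prems_nil)))

/-- The conclusion of the aligned phase: `P_{k-1+j}(V') ≡ P_{k+j}(V)`. [folklore] -/
theorem mem_alUpTo (hk : 1 ≤ k) : ∀ {j i : ℕ}, i < L →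
    ctx K (eqv (V'.P L (k - 1 + j) i) (V.P L (k + j) i)) ∈ alUpTo L K V V' k j
  | 0, i, hi => by rw [show k + 0 = k from rfl]; exact List.mem_map.2 ⟨i, List.mem_range.2 hi, rfl⟩
  | j + 1, i, hi => by
    refine List.mem_append_right _ (List.mem_append_right _ (List.mem_append_right _ ?_))
    have := (⟨V'.Av L (k - 1 + j), V.Av L (k - 1 + j + 1), L⟩ : ModAddU.PairData).mem_leibLines (K := K) hi
    rw [← View.P_succ, ← View.P_succ, show k - 1 + j + 1 = k - 1 + (j + 1) by omega,
      show k - 1 + (j + 1) + 1 = k + (j + 1) by omega] at this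
    exact this

/-- **The aligned phase forms a block.** [cite: CookReckhow1979, §2] -/
theorem isBlock_alUpTo (hGN : ∀ r ∈ Netlist.rules, r ∈ G.rules) (hGL : ∀ r ∈ Logic.rules, r ∈ G.rules) {T : Set (PropForm ℕ)}
    (hV : V.Avail L K T) (hV' : V'.Avail L K T) (hk : 1 ≤ k) (ha : ∀ i < L, V'.a i = V.a i)
    (hn : ∀ i < L, V'.n i = V.n i) (hbb : ∀ t, k ≤ t + 1 → t + 1 < L → V'.b (L - 1 - t) = V.b (L - 1 - (t + 1)))
    (h0' : ∀ i < L, ctx K (neg (var (V'.P L (k - 1) i))) ∈ T) (h0 : ∀ i < L, ctx K (neg (var (V.P L k i))) ∈ T)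
    (hrn : ∀ i < L, ctx K (eqv (V.n i) (V.n i)) ∈ T) (hra : ∀ i < L, ctx K (eqv (V.a i) (V.a i)) ∈ T)
    (hrb : ∀ t < L, ctx K (eqv (V.b (L - 1 - t)) (V.b (L - 1 - t))) ∈ T) :
    ∀ j, k + j ≤ L → G.IsBlock T (alUpTo L K V V' k j) := by
  intro j hj
  induction j with
  | zero =>
    refine Scaffold.isBlock_of_forall fun θ hθ => ?_
    obtain ⟨i, hi, rfl⟩ := List.mem_map.1 hθ
    rw [List.mem_range] at hi
    exact Or.inr (Logic.infer hGL 10 (by decide) (FregeSystem.sub [K, var (V'.P L (k - 1) i), var (V.P L k i)]) rfl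
      (FregeSystem.prems_cons (h0' i hi) (FregeSystem.prems_cons (h0 i hi) FregeSystem.prems_nil)))
  | succ j ih =>
    have ht : k - 1 + j < L := by omega
    have ht1 : k - 1 + j + 1 < L := by omega
    have hT : T ⊆ T ∪ {χ | χ ∈ alUpTo L K V V' k j} := Set.subset_union_left
    have hP : ∀ i < L, ctx K (eqv (V'.P L (k - 1 + j) i) (V.P L (k - 1 + j + 1) i)) ∈ T ∪ {χ | χ ∈ alUpTo L K V V' k j} :=
      fun i hi => by rw [show k - 1 + j + 1 = k + j by omega]; exact Or.inr (mem_alUpTo hk hi)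
    refine (ih (by omega)).append ?_
    refine ((⟨V'.Dv L (k - 1 + j), V.Dv L (k - 1 + j + 1), L⟩ : ModAddU.PairData).isBlock_leibLines hGN hGL
      ((hV'.hD _ ht).mono hT) ((hV.hD _ ht1).mono hT) hP hP (fun i hi => ?_)).append
      ((Scaffold.isBlock_of_forall fun θ hθ => ?_).append ((⟨V'.Av L (k - 1 + j), V.Av L (k - 1 + j + 1), L⟩ : ModAddU.PairData).isBlock_leibLines
        hGN hGL (((hV'.hA _ ht).mono hT).mono (Set.subset_union_left.trans Set.subset_union_left))
        (((hV.hA _ ht1).mono hT).mono (Set.subset_union_left.trans Set.subset_union_left))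
        (fun i hi => ?_) (fun i hi => ?_) (fun i hi => ?_)))
    · show ctx K (eqv (V'.n i) (V.n i)) ∈ _; rw [hn i hi]; exact hT (hrn i hi)
    · obtain ⟨i, hi, rfl⟩ := List.mem_map.1 hθ
      rw [List.mem_range] at hi
      refine Or.inr (FregeSystem.IsInferredFrom.of_rule (hGN _ (rLeib_mem_rules Kind.and))
        (FregeSystem.sub [K, var (V'.msk L (k - 1 + j) i), var (V'.b (L - 1 - (k - 1 + j))), var (V'.a i), const true,
          var (V.msk L (k - 1 + j + 1) i), var (V.b (L - 1 - (k - 1 + j + 1))), var (V.a i), const true]) rfl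
        (FregeSystem.prems_cons (Or.inl (hT (hV'.hmk _ ht i hi))) (FregeSystem.prems_cons (Or.inl (hT (hV.hmk _ ht1 i hi)))
          (FregeSystem.prems_cons ?_ (FregeSystem.prems_cons ?_ FregeSystem.prems_nil)))))
      · show ctx K (eqv (V'.b (L - 1 - (k - 1 + j))) (V.b (L - 1 - (k - 1 + j + 1)))) ∈ _
        rw [hbb _ (by omega) ht1]; exact Or.inl (hT (hrb _ ht1))
      · show ctx K (eqv (V'.a i) (V.a i)) ∈ _; rw [ha i hi]; exact Or.inl (hT (hra i hi))
    · exact Or.inl (Or.inr ((⟨V'.Dv L (k - 1 + j), V.Dv L (k - 1 + j + 1), L⟩ : ModAddU.PairData).mem_leibLines hi))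
    · exact Or.inr (List.mem_map.2 ⟨i, List.mem_range.2 hi, rfl⟩)
    · show ctx K (eqv (V'.n i) (V.n i)) ∈ _; rw [hn i hi]; exact Or.inl (Or.inl (hT (hrn i hi)))

/-- **The shift law of modular multiplication inside Frege.** [cite: CookReckhow1979, §2; Krajicek1995, §9.2] -/
theorem isBlock_lines (hGK : ∀ r ∈ LD.maskRules, r ∈ G.rules) (hGN : ∀ r ∈ Netlist.rules, r ∈ G.rules)
    (hGA : ∀ r ∈ Adder.rules, r ∈ G.rules) (hGL : ∀ r ∈ Logic.rules, r ∈ G.rules)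
    (hV : V.RAvail L K Γ) (hV' : V'.RAvail L K Γ) {z : ℕ} (hk : 1 ≤ k) (hkL : k ≤ L) (ha : ∀ i < L, V'.a i = V.a i)
    (hn : ∀ i < L, V'.n i = V.n i) (hVb : ∀ t < k, V.b (L - 1 - t) = z) (hV'b : ∀ t < k - 1, V'.b (L - 1 - t) = z)
    (hbb : ∀ t, k ≤ t + 1 → t + 1 < L → V'.b (L - 1 - t) = V.b (L - 1 - (t + 1)))
    (hz : ctx K (biimp (var z) (const false)) ∈ Γ) (hlt : ctx K (neg (var ((V.CA L).ge L L))) ∈ Γ)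
    (hlt' : ctx K (neg (var ((V'.CA L).ge L L))) ∈ Γ) : G.IsBlock Γ (lines L K V V' k z) := by
  have s1 : ∀ {A B : Set (PropForm ℕ)}, A ⊆ A ∪ B := fun {_ _} => Set.subset_union_left
  have hz' : G.IsBlock Γ [ctx K (neg (var z))] := FregeSystem.IsBlock.singleton (Or.inr (Logic.infer hGL 11 (by decide)
    (FregeSystem.sub [K, var z]) rfl (FregeSystem.prems_cons hz FregeSystem.prems_nil)))
  refine hz'.append ?_
  refine (isBlock_maskF hGL (hV.hV.mono s1) hkL hVb (Or.inr (List.mem_singleton_self _))).append ?_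
  refine (Zero.isBlock_upTo hGK hGL ((hV.hV.mono s1).mono s1) ((hV.hCA.mono s1).mono s1) (s1 (s1 hlt)) hkL
    (fun t ht i hi => Or.inr (mem_maskF ht hi)) k le_rfl).append ?_
  refine (isBlock_maskF hGL (((hV'.hV.mono s1).mono s1).mono s1) (by omega) hV'b (s1 (s1 (Or.inr (List.mem_singleton_self _))))).append ?_
  refine (Zero.isBlock_upTo hGK hGL ((((hV'.hV.mono s1).mono s1).mono s1).mono s1) ((((hV'.hCA.mono s1).mono s1).mono s1).mono s1)
    (s1 (s1 (s1 (s1 hlt')))) (by omega) (fun t ht i hi => Or.inr (mem_maskF ht hi)) (k - 1) le_rfl).append ?_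
  refine (Adder.isBlock_reflLines hGA K _ _).append ?_
  have rf : ∀ {x : ℕ}, x ∈ (List.range L).map V.n ++ (List.range L).map V.a ++ (List.range L).map (fun t => V.b (L - 1 - t)) →
      ctx K (eqv x x) ∈ Γ ∪ {χ | χ ∈ [ctx K (neg (var z))]} ∪ {χ | χ ∈ maskF L K V k} ∪ {χ | χ ∈ Zero.upTo V L K k} ∪
        {χ | χ ∈ maskF L K V' (k - 1)} ∪ {χ | χ ∈ Zero.upTo V' L K (k - 1)} ∪
        {χ | χ ∈ Adder.reflLines K ((List.range L).map V.n ++ (List.range L).map V.a ++ (List.range L).map fun t => V.b (L - 1 - t))} :=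
    fun hx => Or.inr (Adder.mem_reflLines hx)
  refine isBlock_alUpTo hGN hGL ((((((hV.hV.mono s1).mono s1).mono s1).mono s1).mono s1).mono s1)
    ((((((hV'.hV.mono s1).mono s1).mono s1).mono s1).mono s1).mono s1) hk ha hn hbb (fun i hi => ?_) (fun i hi => ?_)
    (fun i hi => rf (by simp only [List.mem_append, List.mem_map, List.mem_range]; exact Or.inl (Or.inl ⟨i, hi, rfl⟩)))
    (fun i hi => rf (by simp only [List.mem_append, List.mem_map, List.mem_range]; exact Or.inl (Or.inr ⟨i, hi, rfl⟩)))
    (fun t ht => rf (by simp only [List.mem_append, List.mem_map, List.mem_range]; exact Or.inr ⟨t, ht, rfl⟩)) (L - k) (by omega)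
  · exact s1 (Or.inr (Zero.mem_upTo hi))
  · exact s1 (s1 (s1 (Or.inr (Zero.mem_upTo hi))))

/-- **The conclusion of the shift law**: `P_{L-1}(V')ᵢ ↔ P_L(V)ᵢ`. [folklore] -/
theorem mem_lines {z i : ℕ} (hk : 1 ≤ k) (hkL : k ≤ L) (hi : i < L) :
    ctx K (eqv (V'.P L (L - 1) i) (V.P L L i)) ∈ lines L K V V' k z := by
  have := mem_alUpTo (L := L) (K := K) (V := V) (V' := V') hk (j := L - k) hi
  rw [show k - 1 + (L - k) = L - 1 by omega, show k + (L - k) = L by omega] at this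
  exact List.mem_append_right _ (List.mem_append_right _ (List.mem_append_right _ (List.mem_append_right _
    (List.mem_append_right _ (List.mem_append_right _ this)))))

/-- **Size of the shift law**: `≤ (32L² + 20L + 4)(|K| + 12)`. [folklore] -/
theorem proofSize_lines (z : ℕ) (hkL : k ≤ L) : proofSize (lines L K V V' k z) ≤ (32 * L * L + 20 * L + 4) * (K.size + 12) := by
  have hm : ∀ (W : View) (k' : ℕ), k' ≤ L → proofSize (maskF L K W k') ≤ L * L * (K.size + 3) := by
    intro W k' hk'
    refine (ModAddU.Bounded.proofSize_le (B := K.size + 3) fun θ hθ => ?_).trans ?_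
    · obtain ⟨l, hl, hθ⟩ := List.mem_flatten.1 hθ
      obtain ⟨t, -, rfl⟩ := List.mem_map.1 hl
      obtain ⟨i, -, rfl⟩ := List.mem_map.1 hθ
      rw [ModAddU.size_ctx]; simp [size]
    · apply Nat.mul_le_mul_right
      simp only [maskF, List.length_flatten, List.map_map]
      rw [show (List.map (List.length ∘ fun t => List.map (fun i => ctx K (neg (var (W.msk L t i)))) (List.range L)) (List.range k')) =
        (List.range k').map (fun _ => L) from List.map_congr_left fun t _ => by simp]
      simp [List.sum_replicate]; nlinarith
  have hz1 := Zero.proofSize_upTo (V := V) (L := L) (K := K) k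
  have hz2 := Zero.proofSize_upTo (V := V') (L := L) (K := K) (k - 1)
  have hr : proofSize (Adder.reflLines K ((List.range L).map V.n ++ (List.range L).map V.a ++ (List.range L).map (fun t => V.b (L - 1 - t)))) ≤
      3 * L * (K.size + 10) := by
    refine (ModAddU.bounded_refl K _ le_rfl).proofSize_le.trans ?_
    simp [Adder.reflLines]; nlinarith
  have hal : ∀ j, proofSize (alUpTo L K V V' k j) ≤ L * (K.size + 10) + j * ((13 * L + 4) * (K.size + 10)) := by
    intro j
    induction j with
    | zero =>
      refine ((ModAddU.bounded_ctx_eqv K le_rfl _ _ _).proofSize_le).trans ?_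
      simp
    | succ j ih =>
      rw [alUpTo, proofSize_append]
      have hs : proofSize (stage L K V V' (k - 1 + j)) ≤ (13 * L + 4) * (K.size + 10) := by
        rw [stage, proofSize_append, proofSize_append]
        have h1 := (⟨V'.Dv L (k - 1 + j), V.Dv L (k - 1 + j + 1), L⟩ : ModAddU.PairData).proofSize_leibLines (K := K)
        have h2 := (⟨V'.Av L (k - 1 + j), V.Av L (k - 1 + j + 1), L⟩ : ModAddU.PairData).proofSize_leibLines (K := K)
        have h3 := (ModAddU.bounded_ctx_eqv K le_rfl (List.range L) (V'.msk L (k - 1 + j)) (V.msk L (k - 1 + j + 1))).proofSize_le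
        simp only [List.length_map, List.length_range] at h3
        dsimp only at h1 h2
        nlinarith
      calc _ ≤ L * (K.size + 10) + j * ((13 * L + 4) * (K.size + 10)) + (13 * L + 4) * (K.size + 10) := Nat.add_le_add ih hs
        _ = _ := by ring
  simp only [lines, proofSize_append]
  have h0 : proofSize [ctx K (neg (var z))] ≤ K.size + 12 := by
    refine (ModAddU.Bounded.proofSize_le (B := K.size + 12) (ModAddU.Bounded.singleton ?_)).trans (by simp)
    rw [ModAddU.size_ctx]; simp [size]
  have hk1 : k - 1 ≤ L := by omega
  have e1 : proofSize (Zero.upTo V L K k) ≤ (1 + L * (8 * L + 4)) * (K.size + 12) :=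
    hz1.trans (Nat.mul_le_mul_right _ (Nat.add_le_add_left (Nat.mul_le_mul_right _ hkL) _))
  have e2 : proofSize (Zero.upTo V' L K (k - 1)) ≤ (1 + L * (8 * L + 4)) * (K.size + 12) :=
    hz2.trans (Nat.mul_le_mul_right _ (Nat.add_le_add_left (Nat.mul_le_mul_right _ hk1) _))
  have e3 : proofSize (alUpTo L K V V' k (L - k)) ≤ L * (K.size + 10) + L * ((13 * L + 4) * (K.size + 10)) :=
    (hal (L - k)).trans (Nat.add_le_add_left (Nat.mul_le_mul_right _ (Nat.sub_le L k)) _)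
  have e4 := hm V k hkL
  have e5 := hm V' (k - 1) hk1
  nlinarith [h0, e1, e2, e3, e4, e5, hr, Nat.zero_le K.size, Nat.zero_le L]

end ShiftMul

end ModMulU

end Literature.Computability.MetaComplexity
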